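import Summits.HubbardSuperconductivity.HubbardSuperconductivity.Theorems.AnisotropyChordTransferFibre3TargetsV2

/-!
# Route `AnisotropyChord` / H0 rotor rung: PORT N30-A — the (KT-2) SPLIT-form cruxes (theory seat's PartN30, third revision)

Verbatim port of the declarations ADDED to `hubbard-h0-rotor-theory-1/cycle20/lean/PartN30.lean` after the revision landed as
`…TransferFibre3TargetsV2` (theory file sha16 `016653694cdcefe7`, 14:38Z, lines 326–371; memo ROTOR-THEORY-20 §288–§290):
the configuration-space DFT `cfgDFT`, the low-shell predicate `IsLowShell`, the two (KT-2) cruxes in split form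
`LowShellGFormUB` (KT-2a) and `FullResidualUB` (KT-2b), the split assemblies `KTSplitAssembly`, `KTSplitAssemblyCS`, and `kappaE`.
All earlier declarations of PartN30 are unchanged and live in `…TransferFibre3` / `…TransferFibre3TargetsV2` (checked decl by decl).
Statements only (targets typed by the theory seat; no proofs claimed here).  Prover seat `hubbard-h0-rotor-p1` g21; helper for
stmt-HubbardSuperconductivity-19089 (`--supports`).
-/

set_option linter.dupNamespace false
set_option autoImplicit false

noncomputable section

open scoped BigOperators

namespace Summit.HubbardSuperconductivity.HubbardSuperconductivity.Theorems.AnisotropyChord.Transfer.Fibre3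

variable (L : ℕ) [NeZero L]

/-! ## (KT-2) in the provable SPLIT form (memo 20 §288): the two lowest non-pole shells exactly, the rest by Temple
with the FULL residual norm (poles and low shells counted again, at weight `1/den_min(rest)`). -/

/-- configuration-space Fourier coefficient `R̂(k₂,k₃) = Σ_{(a,b)} e^{−i(k₂a + k₃b)} R(a,b)`. -/
noncomputable def cfgDFT (R : Cfg L → ℂ) (k₂ k₃ : Tor L) : ℂ :=
  ∑ c : Cfg L, (starRingEnd ℂ) (phase L k₂ c.1 * phase L k₃ c.2) * R c

/-- the two lowest non-pole free shells of the `K₁` fibre: `Σ_i |m_i|² ∈ {3, 5}` in units of the smallest momentum,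
cut at free energy `< 5.5 ε₁` (45 points, an `L`-independent list for `L ≥ 8`). -/
def IsLowShell (k₂ k₃ : Tor L) : Prop :=
  IsPoleK1 L k₂ k₃ = false ∧ epsT L (K1 L - k₂ - k₃) + epsT L k₂ + epsT L k₃ < 5.5 * eps1 L

/-- (KT-2a) LOW-SHELL G-FORM BOUND (crux; measured constant `≈ .031–.045`):
`Σ_{low shells} |R̂′(k)|² / (V² den(k)) ≤ a · η_eff · 3V² T⁺ · β²` for the (unprojected) off-`D` residual `R′`. -/
def LowShellGFormUB (Δ lam2 a : ℝ) : Prop :=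
  ∀ f : Tor L → ℝ, IsTwoMagnon L Δ lam2 f →
    ∀ S : Finset (Tor L × Tor L), (∀ k ∈ S, IsLowShell L k.1 k.2) →
      (∑ k ∈ S, Complex.normSq (cfgDFT L (residual L (Tplus L Δ f) Δ (trialK1 L f)) k.1 k.2)
          / ((((L : ℝ) ^ 2) ^ 2) * den L (Tplus L Δ f) k.1 k.2))
        ≤ a * ((L : ℝ) ^ 2 * lam2 / 4) * (3 * ((L : ℝ) ^ 2) ^ 2) * Tplus L Δ f * betaOverlap L f ^ 2

/-- (KT-2b) FULL RESIDUAL NORM BOUND (crux; measured constant `≈ .17–.25`, no `ln L`; poles INCLUDED, so the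
Cauchy–Schwarz bound on the carré du champ of memo 20 §285(e) is admissible):
`‖R′‖² ≤ b · η_eff · (2ε₁ − T⁺) · 3V² T⁺ · β²`. -/
def FullResidualUB (Δ lam2 b : ℝ) : Prop :=
  ∀ f : Tor L → ℝ, IsTwoMagnon L Δ lam2 f →
    (ip L (residual L (Tplus L Δ f) Δ (trialK1 L f)) (residual L (Tplus L Δ f) Δ (trialK1 L f))).re
      ≤ b * ((L : ℝ) ^ 2 * lam2 / 4) * (2 * eps1 L - Tplus L Δ f)
          * (3 * ((L : ℝ) ^ 2) ^ 2) * Tplus L Δ f * betaOverlap L f ^ 2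

/-- THE SPLIT ASSEMBLY (memo 20 §288): `⟨R′,GR′⟩ ≤ (a + b·(2ε₁−T⁺)/den_min(rest))·η_eff·3V²T⁺β² ≤ (a + b/2.8)·η_eff·…`,
and with `a = .05`, `b = .27`, `c₁ = .64` the master inequality closes for all `Δ ∈ (0,1)`, `L ≥ 8` with margin `≥ .2`. -/
def KTSplitAssembly (Δ lam2 : ℝ) : Prop :=
  8 ≤ L → 0 < Δ → Δ < 1 → (∃ f : Tor L → ℝ, IsTwoMagnon L Δ lam2 f) →
    TrialGapLB L Δ lam2 0.64 → LowShellGFormUB L Δ lam2 0.05 → FullResidualUB L Δ lam2 0.27 → GM3Fibre L Δ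

/-- `κ_E := 3ε₁/(2ε₁ − T⁺)` — the sharp replacement of the factor `3` in the master inequality (memo 20 §290:
`H₀ ≥ 3ε₁` exactly on the pole complement, so `H₀/(H₀ − E) ≤ 3ε₁/(3ε₁ − E)` mode by mode); `≤ 1.9` always, `→ 1.5` in the corner. -/
noncomputable def kappaE (Δ : ℝ) (f : Tor L → ℝ) : ℝ := 3 * eps1 L / (2 * eps1 L - Tplus L Δ f)

/-- THE CAUCHY–SCHWARZ ASSEMBLY (memo 20 §290(c)): with `κ_E` in the master inequality the generous constants
`(c₁, a, b) = (.64, .05, .75)` already close GM₃ for all `Δ ∈ (0,1)`, `L ≥ 8` (margin `≥ .1`); `b = .75` is reachable by plain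
Cauchy–Schwarz over the exact pair split `MIXED = E₁₂ + E₁₃ + E₂₃` (memo 20 §289). -/
def KTSplitAssemblyCS (Δ lam2 : ℝ) : Prop :=
  8 ≤ L → 0 < Δ → Δ < 1 → (∃ f : Tor L → ℝ, IsTwoMagnon L Δ lam2 f) →
    TrialGapLB L Δ lam2 0.64 → LowShellGFormUB L Δ lam2 0.05 → FullResidualUB L Δ lam2 0.75 → GM3Fibre L Δ

/-- THE CAUCHY–SCHWARZ ASSEMBLY, constants of the theory file's revision of 14:50Z (sha16 `33f5f37111e64788`):
`(c₁, a, b) = (.64, .07, .8)` (the only change w.r.t. `KTSplitAssemblyCS`, whose `(.05, .75)` were superseded;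
append-only tree ⇒ new name). -/
def KTSplitAssemblyCS2 (Δ lam2 : ℝ) : Prop :=
  8 ≤ L → 0 < Δ → Δ < 1 → (∃ f : Tor L → ℝ, IsTwoMagnon L Δ lam2 f) →
    TrialGapLB L Δ lam2 0.64 → LowShellGFormUB L Δ lam2 0.07 → FullResidualUB L Δ lam2 0.8 → GM3Fibre L Δ

end Summit.HubbardSuperconductivity.HubbardSuperconductivity.Theorems.AnisotropyChord.Transfer.Fibre3

end
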